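import Summits.KontsevichZagierPeriods.KontsevichZagierPeriods.Theorems.HyperbolicBlochOffTetraSectorKernelPolytopeEnvelopeCusp
import Literature.NumberTheory.Transcendental.KZCalculusProofs

/-!
# Towards `stub_polytopeEnvelope`, floor-freeness of the normalised cusp — crux `OffTetraSectorKernel` (v5, lead c3)

For a finite-volume normal-form polytope `P` and a floor point `n` separated from the other floor candidates by
`> 2ρ`, the Möbius image `Q` (translation by `−n`, unit inversion) of the cusp piece `P ∩ ball((n,0), ρ)` is
FLOOR-FREE and has bounded shadow: `Q ⊆ {|q| < M', δ' < t}` (`polyEnv_image_boxed`). Inputs (hypotheses, the shape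
of the registered stub `stub_floorClearance`): finite volume forces bounded shadow and floor clearance. Pointwise
floor-freeness (`polyEnv_free_ball_at_floor_point`): floor points `c` with `|c| < 1/ρ` lie under the complementary
ball, which misses `Q`; those with `|c| ≥ 1/ρ` are images of floor points `ψ(c) = n + c/|c|²` at distance `≤ ρ`
from `n`, which are not candidates (the next candidate is `> 2ρ` away), hence not approached by `P`
(`polyEnv_free_ball_of_not_candidate`), which transports to a `Q`-free ball around `(c, 0)`. Uniformity over the
compact floor disc of radius `M'` by a Lebesgue number.

References: R. Benedetti, C. Petronio, *Lectures on Hyperbolic Geometry* (1992), A.3.5.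
-/

noncomputable section

open Set MeasureTheory Filter Topology
open Literature.NumberTheory.Transcendental

namespace Summit.KontsevichZagierPeriods.HyperbolicBloch.OffTetraSectorKernel

/-! ### Points of the floor outside the candidate set are not approached -/

/-- **Non-candidates are not approached.** If floor clearance holds for `P` (below height `δ(η)` every point is within
`η` of a candidate) and the candidate set is finite, then around every floor point `c₀` which is NOT a candidate there
is a ball of `ℝ³` free of `P`. [folklore] -/
theorem polyEnv_free_ball_of_not_candidate {P : Set (Fin 3 → ℝ)} {C : Set (Fin 2 → ℝ)} (hC : C.Finite)
    (hclear : ∀ η : ℝ, 0 < η → ∃ δ : ℝ, 0 < δ ∧ ∀ p ∈ P, p 2 < δ → ∃ n : Fin 2 → ℝ,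
      n ∈ C ∧ (p 0 - n 0) ^ 2 + (p 1 - n 1) ^ 2 < η ^ 2)
    (hP : P ⊆ {p | 0 < p 2}) (c₀ : Fin 2 → ℝ) (hc₀ : c₀ ∉ C) :
    ∃ ε : ℝ, 0 < ε ∧ ∀ p ∈ P, ε ^ 2 ≤ (p 0 - c₀ 0) ^ 2 + (p 1 - c₀ 1) ^ 2 + p 2 ^ 2 := by
  classical
  -- a positive lower bound `2η` for the distances from `c₀` to the candidates
  obtain ⟨η, hη, hfar⟩ : ∃ η : ℝ, 0 < η ∧ ∀ n ∈ C, (2 * η) ^ 2 ≤ (c₀ 0 - n 0) ^ 2 + (c₀ 1 - n 1) ^ 2 := by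
    by_cases hCe : C = ∅
    · exact ⟨1, one_pos, by simp [hCe]⟩
    · have hne : hC.toFinset.Nonempty := by
        rw [Finite.toFinset_nonempty]
        exact nonempty_iff_ne_empty.mpr hCe
      set d : (Fin 2 → ℝ) → ℝ := fun n => (c₀ 0 - n 0) ^ 2 + (c₀ 1 - n 1) ^ 2 with hd
      obtain ⟨n₁, hn₁, hmin⟩ := hC.toFinset.exists_min_image d hne
      have hpos : 0 < d n₁ := by
        have hn₁C : n₁ ∈ C := (Finite.mem_toFinset hC).mp hn₁
        have hne' : c₀ ≠ n₁ := fun h => hc₀ (h ▸ hn₁C)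
        rw [hd]
        dsimp only
        by_contra hle
        push Not at hle
        have h0 : (c₀ 0 - n₁ 0) ^ 2 = 0 := by nlinarith [sq_nonneg (c₀ 0 - n₁ 0), sq_nonneg (c₀ 1 - n₁ 1)]
        have h1 : (c₀ 1 - n₁ 1) ^ 2 = 0 := by nlinarith [sq_nonneg (c₀ 0 - n₁ 0), sq_nonneg (c₀ 1 - n₁ 1)]
        apply hne'
        ext i
        fin_cases i
        · exact sub_eq_zero.mp ((pow_eq_zero_iff two_ne_zero).mp h0)
        · exact sub_eq_zero.mp ((pow_eq_zero_iff two_ne_zero).mp h1)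
      refine ⟨Real.sqrt (d n₁) / 2, by positivity, fun n hn => ?_⟩
      have := hmin n ((Finite.mem_toFinset hC).mpr hn)
      calc (2 * (Real.sqrt (d n₁) / 2)) ^ 2 = d n₁ := by
            rw [mul_div_cancel₀ _ two_ne_zero, Real.sq_sqrt hpos.le]
        _ ≤ d n := this
  obtain ⟨δ, hδ, hcl⟩ := hclear η hη
  refine ⟨min η δ, lt_min hη hδ, fun p hp => ?_⟩
  by_contra hlt
  push Not at hlt
  have hm1 : min η δ ≤ η := min_le_left _ _
  have hm2 : min η δ ≤ δ := min_le_right _ _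
  have hm0 : 0 < min η δ := lt_min hη hδ
  have ht : p 2 < δ := by
    have : p 2 ^ 2 < (min η δ) ^ 2 := by nlinarith [sq_nonneg (p 0 - c₀ 0), sq_nonneg (p 1 - c₀ 1)]
    have hp2 : 0 < p 2 := hP hp
    nlinarith
  obtain ⟨n, hnC, hnear⟩ := hcl p hp ht
  have hq : (p 0 - c₀ 0) ^ 2 + (p 1 - c₀ 1) ^ 2 < η ^ 2 := by nlinarith [sq_nonneg (p 2)]
  -- triangle inequality in squared form: |c₀ − n| ≤ |c₀ − q| + |q − n| < 2η
  have key := hfar n hnC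
  have hx : |c₀ 0 - n 0| ≤ |p 0 - c₀ 0| + |p 0 - n 0| := by
    have : c₀ 0 - n 0 = -(p 0 - c₀ 0) + (p 0 - n 0) := by ring
    rw [this]
    exact (abs_add_le _ _).trans (by rw [abs_neg])
  have hy : |c₀ 1 - n 1| ≤ |p 1 - c₀ 1| + |p 1 - n 1| := by
    have : c₀ 1 - n 1 = -(p 1 - c₀ 1) + (p 1 - n 1) := by ring
    rw [this]
    exact (abs_add_le _ _).trans (by rw [abs_neg])
  -- Minkowski in ℝ²
  have hA : Real.sqrt ((p 0 - c₀ 0) ^ 2 + (p 1 - c₀ 1) ^ 2) < η := by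
    rw [show η = Real.sqrt (η ^ 2) by rw [Real.sqrt_sq hη.le]]
    exact Real.sqrt_lt_sqrt (by positivity) hq
  have hB : Real.sqrt ((p 0 - n 0) ^ 2 + (p 1 - n 1) ^ 2) < η := by
    rw [show η = Real.sqrt (η ^ 2) by rw [Real.sqrt_sq hη.le]]
    exact Real.sqrt_lt_sqrt (by positivity) hnear
  have hM : Real.sqrt ((c₀ 0 - n 0) ^ 2 + (c₀ 1 - n 1) ^ 2) ≤
      Real.sqrt ((p 0 - c₀ 0) ^ 2 + (p 1 - c₀ 1) ^ 2) + Real.sqrt ((p 0 - n 0) ^ 2 + (p 1 - n 1) ^ 2) := by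
    -- use the Euclidean norm on `EuclideanSpace ℝ (Fin 2)`
    have e : ∀ u v : ℝ, Real.sqrt (u ^ 2 + v ^ 2) = ‖(WithLp.equiv 2 (Fin 2 → ℝ)).symm ![u, v]‖ := by
      intro u v
      rw [EuclideanSpace.norm_eq, Fin.sum_univ_two]
      simp [Real.norm_eq_abs, sq_abs]
    rw [e, e, e]
    have hsum : (WithLp.equiv 2 (Fin 2 → ℝ)).symm ![c₀ 0 - n 0, c₀ 1 - n 1] =
        -(WithLp.equiv 2 (Fin 2 → ℝ)).symm ![p 0 - c₀ 0, p 1 - c₀ 1] +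
          (WithLp.equiv 2 (Fin 2 → ℝ)).symm ![p 0 - n 0, p 1 - n 1] := by
      ext i
      fin_cases i <;> simp
    rw [hsum]
    exact (norm_add_le _ _).trans (by rw [norm_neg])
  have h2 : Real.sqrt ((c₀ 0 - n 0) ^ 2 + (c₀ 1 - n 1) ^ 2) < 2 * η := by linarith
  have h3 : (c₀ 0 - n 0) ^ 2 + (c₀ 1 - n 1) ^ 2 < (2 * η) ^ 2 := by
    have h4 := Real.sqrt_lt' (by positivity : 0 < 2 * η) |>.mp h2
    exact h4
  linarith


/-! ### Algebra of the transformed traces -/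

/-- The floor trace of a transformed row at `c ≠ 0` is `|c|²` times the original floor trace at `ψ(c) = n + c/|c|²`.
[cite: BenedettiPetronio1992, A.3.5] -/
theorem polyEnv_trace_transform (m : Fin 4 → ℝ) (n c : Fin 2 → ℝ) (hs : c 0 ^ 2 + c 1 ^ 2 ≠ 0) :
    (m 0 * (n 0 ^ 2 + n 1 ^ 2) + m 1 * n 0 + m 2 * n 1 + m 3) * (c 0 ^ 2 + c 1 ^ 2) +
        (2 * n 0 * m 0 + m 1) * c 0 + (2 * n 1 * m 0 + m 2) * c 1 + m 0 =
      (c 0 ^ 2 + c 1 ^ 2) * (m 0 * ((n 0 + c 0 / (c 0 ^ 2 + c 1 ^ 2)) ^ 2 + (n 1 + c 1 / (c 0 ^ 2 + c 1 ^ 2)) ^ 2) +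
        m 1 * (n 0 + c 0 / (c 0 ^ 2 + c 1 ^ 2)) + m 2 * (n 1 + c 1 / (c 0 ^ 2 + c 1 ^ 2)) + m 3) := by
  field_simp
  ring

/-- The point `ψ(c) = n + c/|c|²` is at squared distance `1/|c|²` from `n`. [folklore] -/
theorem polyEnv_psi_dist (n c : Fin 2 → ℝ) (hs : c 0 ^ 2 + c 1 ^ 2 ≠ 0) :
    (n 0 + c 0 / (c 0 ^ 2 + c 1 ^ 2) - n 0) ^ 2 + (n 1 + c 1 / (c 0 ^ 2 + c 1 ^ 2) - n 1) ^ 2 =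
      1 / (c 0 ^ 2 + c 1 ^ 2) := by
  field_simp
  ring

/-- Euclidean norm of a triple as the norm in `EuclideanSpace ℝ (Fin 3)`. [folklore] -/
theorem polyEnv_sqrt_three_eq_norm (u v w : ℝ) :
    Real.sqrt (u ^ 2 + v ^ 2 + w ^ 2) = ‖(WithLp.equiv 2 (Fin 3 → ℝ)).symm ![u, v, w]‖ := by
  rw [EuclideanSpace.norm_eq, Fin.sum_univ_three]
  simp [Real.norm_eq_abs, sq_abs]

/-- Reverse triangle inequality for Euclidean norms of triples. [folklore] -/
theorem polyEnv_reverse_triangle (q c : Fin 3 → ℝ) :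
    Real.sqrt (q 0 ^ 2 + q 1 ^ 2 + q 2 ^ 2) - Real.sqrt (c 0 ^ 2 + c 1 ^ 2 + c 2 ^ 2) ≤
      Real.sqrt ((q 0 - c 0) ^ 2 + (q 1 - c 1) ^ 2 + (q 2 - c 2) ^ 2) := by
  rw [polyEnv_sqrt_three_eq_norm, polyEnv_sqrt_three_eq_norm, polyEnv_sqrt_three_eq_norm]
  have h : (WithLp.equiv 2 (Fin 3 → ℝ)).symm ![q 0, q 1, q 2] =
      (WithLp.equiv 2 (Fin 3 → ℝ)).symm ![q 0 - c 0, q 1 - c 1, q 2 - c 2] +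
        (WithLp.equiv 2 (Fin 3 → ℝ)).symm ![c 0, c 1, c 2] := by
    ext i; fin_cases i <;> simp
  rw [h]
  linarith [norm_add_le ((WithLp.equiv 2 (Fin 3 → ℝ)).symm ![q 0 - c 0, q 1 - c 1, q 2 - c 2])
    ((WithLp.equiv 2 (Fin 3 → ℝ)).symm ![c 0, c 1, c 2])]

/-- Metric continuity of `q ↦ J q + (n, 0)` at a point `c ≠ 0`, in Euclidean squared form. [folklore] -/
theorem polyEnv_back_continuous (n : Fin 2 → ℝ) (c : Fin 3 → ℝ) (hc : c 0 ^ 2 + c 1 ^ 2 + c 2 ^ 2 ≠ 0)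
    (ε₀ : ℝ) (hε₀ : 0 < ε₀) :
    ∃ ε : ℝ, 0 < ε ∧ ∀ q : Fin 3 → ℝ, (q 0 - c 0) ^ 2 + (q 1 - c 1) ^ 2 + (q 2 - c 2) ^ 2 < ε ^ 2 →
      (q 0 / (q 0 ^ 2 + q 1 ^ 2 + q 2 ^ 2) + n 0 - (c 0 / (c 0 ^ 2 + c 1 ^ 2 + c 2 ^ 2) + n 0)) ^ 2 +
        (q 1 / (q 0 ^ 2 + q 1 ^ 2 + q 2 ^ 2) + n 1 - (c 1 / (c 0 ^ 2 + c 1 ^ 2 + c 2 ^ 2) + n 1)) ^ 2 +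
        (q 2 / (q 0 ^ 2 + q 1 ^ 2 + q 2 ^ 2) - c 2 / (c 0 ^ 2 + c 1 ^ 2 + c 2 ^ 2)) ^ 2 < ε₀ ^ 2 := by
  -- the map is continuous at `c` as a map of `Fin 3 → ℝ` (sup metric)
  set F : (Fin 3 → ℝ) → (Fin 3 → ℝ) := fun q =>
    ![q 0 / (q 0 ^ 2 + q 1 ^ 2 + q 2 ^ 2) + n 0, q 1 / (q 0 ^ 2 + q 1 ^ 2 + q 2 ^ 2) + n 1,
      q 2 / (q 0 ^ 2 + q 1 ^ 2 + q 2 ^ 2)] with hF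
  have hS : ContinuousAt (fun q : Fin 3 → ℝ => q 0 ^ 2 + q 1 ^ 2 + q 2 ^ 2) c := by fun_prop
  have hFc : ContinuousAt F c := by
    rw [hF, continuousAt_pi]
    intro l
    fin_cases l
    · exact ((continuousAt_apply 0 c).div hS hc).add continuousAt_const
    · exact ((continuousAt_apply 1 c).div hS hc).add continuousAt_const
    · exact (continuousAt_apply 2 c).div hS hc
  have hε' : 0 < ε₀ / 2 := by linarith
  obtain ⟨δ, hδ, hcont⟩ := Metric.continuousAt_iff.mp hFc (ε₀ / 2) hε'
  refine ⟨δ, hδ, fun q hq => ?_⟩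
  have hdq : dist q c < δ := by
    rw [dist_pi_lt_iff hδ]
    have hx : |q 0 - c 0| < δ :=
      abs_lt_of_sq_lt_sq (by nlinarith [sq_nonneg (q 1 - c 1), sq_nonneg (q 2 - c 2)]) hδ.le
    have hy : |q 1 - c 1| < δ :=
      abs_lt_of_sq_lt_sq (by nlinarith [sq_nonneg (q 0 - c 0), sq_nonneg (q 2 - c 2)]) hδ.le
    have hz : |q 2 - c 2| < δ :=
      abs_lt_of_sq_lt_sq (by nlinarith [sq_nonneg (q 0 - c 0), sq_nonneg (q 1 - c 1)]) hδ.le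
    intro l
    rw [Real.dist_eq]
    fin_cases l
    · exact hx
    · exact hy
    · exact hz
  have hd := hcont hdq
  rw [dist_pi_lt_iff hε'] at hd
  have h0 := hd 0
  have h1 := hd 1
  have h2 := hd 2
  simp only [hF, Real.dist_eq, Matrix.cons_val_zero, Matrix.cons_val_one, Matrix.cons_val_two, Matrix.head_cons,
    Matrix.tail_cons] at h0 h1 h2
  have e0 := sq_lt_sq' (abs_lt.mp h0).1 (abs_lt.mp h0).2
  have e1 := sq_lt_sq' (abs_lt.mp h1).1 (abs_lt.mp h1).2
  have e2 := sq_lt_sq' (abs_lt.mp h2).1 (abs_lt.mp h2).2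
  nlinarith

/-! ### Every floor point has a neighbourhood free of the normalised cusp -/

/-- **The normalised cusp is floor-free, pointwise.** Let `Q` be the Möbius image (translation by `−n`, unit
inversion) of the cusp piece `P ∩ ball((n,0), ρ)`, where every floor candidate of `P` other than `n` is `> 2ρ` away
from `n` and every non-candidate floor point has a `P`-free ball around it. Then EVERY floor point `c` has a `Q`-free
ball around `(c, 0)`: for `|c| < 1/ρ` because `Q` lies outside the ball of radius `1/ρ`, for `|c| ≥ 1/ρ` because
`c` is the image of the floor point `ψ(c) = n + c/|c|²` at distance `≤ ρ` from `n`, which is not a candidate.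
[cite: BenedettiPetronio1992, A.3.5] -/
theorem polyEnv_free_ball_at_floor_point : ∀ (P : Set (Fin 3 → ℝ)), P ⊆ {p | 0 < p 2} →
    ∀ (C : Set (Fin 2 → ℝ)) (n : Fin 2 → ℝ) (ρ : ℝ), 0 < ρ →
    (∀ c₀ ∈ C, c₀ ≠ n → (2 * ρ) ^ 2 < (c₀ 0 - n 0) ^ 2 + (c₀ 1 - n 1) ^ 2) →
    (∀ c₀ : Fin 2 → ℝ, c₀ ∉ C →
      ∃ ε : ℝ, 0 < ε ∧ ∀ p ∈ P, ε ^ 2 ≤ (p 0 - c₀ 0) ^ 2 + (p 1 - c₀ 1) ^ 2 + p 2 ^ 2) →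
    ∀ (Q : Set (Fin 3 → ℝ)), Q = KZ.unitInversion 2 '' (KZ.boundarySimilarity 2 1 1 ![-n 0, -n 1] ''
      (P ∩ {p | (p 0 - n 0) ^ 2 + (p 1 - n 1) ^ 2 + p 2 ^ 2 < ρ ^ 2})) →
    ∀ (c : Fin 2 → ℝ), ∃ ε : ℝ, 0 < ε ∧ ∀ q ∈ Q, ε ^ 2 ≤ (q 0 - c 0) ^ 2 + (q 1 - c 1) ^ 2 + q 2 ^ 2 := by
  intro P hPsub C n ρ hρ hsep hfree Q hQ c
  have hsub' : P ∩ {p | (p 0 - n 0) ^ 2 + (p 1 - n 1) ^ 2 + p 2 ^ 2 < ρ ^ 2} ⊆ {p | 0 < p 2} :=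
    fun p hp => hPsub hp.1
  -- what membership in `Q` means
  have hmem : ∀ q ∈ Q, 0 < q 2 ∧
      (![q 0 / (q 0 ^ 2 + q 1 ^ 2 + q 2 ^ 2) + n 0, q 1 / (q 0 ^ 2 + q 1 ^ 2 + q 2 ^ 2) + n 1,
        q 2 / (q 0 ^ 2 + q 1 ^ 2 + q 2 ^ 2)] : Fin 3 → ℝ) ∈ P ∧
      1 / ρ ^ 2 < q 0 ^ 2 + q 1 ^ 2 + q 2 ^ 2 := by
    intro q hq
    rw [hQ, polyEnv_mem_image_iff n hsub'] at hq
    obtain ⟨hq2, hP, hball⟩ := hq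
    refine ⟨hq2, hP, ?_⟩
    simp only [mem_setOf_eq, Matrix.cons_val_zero, Matrix.cons_val_one, Matrix.cons_val_two, Matrix.head_cons,
      Matrix.tail_cons, add_sub_cancel_right] at hball
    have hS : 0 < q 0 ^ 2 + q 1 ^ 2 + q 2 ^ 2 := by positivity
    have e : (q 0 / (q 0 ^ 2 + q 1 ^ 2 + q 2 ^ 2)) ^ 2 + (q 1 / (q 0 ^ 2 + q 1 ^ 2 + q 2 ^ 2)) ^ 2 +
        (q 2 / (q 0 ^ 2 + q 1 ^ 2 + q 2 ^ 2)) ^ 2 = 1 / (q 0 ^ 2 + q 1 ^ 2 + q 2 ^ 2) := by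
      field_simp
    rw [e, div_lt_iff₀ hS] at hball
    rw [div_lt_iff₀ (by positivity)]
    linarith
  by_cases hs : c 0 ^ 2 + c 1 ^ 2 < 1 / ρ ^ 2
  · -- (i) `|c| < 1/ρ`: `Q` lies outside the ball of radius `1/ρ`
    have hlt : Real.sqrt (c 0 ^ 2 + c 1 ^ 2) < 1 / ρ := by
      rw [show 1 / ρ = Real.sqrt ((1 / ρ) ^ 2) by rw [Real.sqrt_sq (by positivity)]]
      exact Real.sqrt_lt_sqrt (by positivity) (by rw [one_div, inv_pow, ← one_div]; exact hs)
    refine ⟨1 / ρ - Real.sqrt (c 0 ^ 2 + c 1 ^ 2), by linarith, fun q hq => ?_⟩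
    obtain ⟨-, -, hnorm⟩ := hmem q hq
    have hq1 : 1 / ρ < Real.sqrt (q 0 ^ 2 + q 1 ^ 2 + q 2 ^ 2) := by
      rw [show 1 / ρ = Real.sqrt ((1 / ρ) ^ 2) by rw [Real.sqrt_sq (by positivity)]]
      exact Real.sqrt_lt_sqrt (by positivity) (by rw [one_div, inv_pow, ← one_div]; exact hnorm)
    have hrev := polyEnv_reverse_triangle q ![c 0, c 1, 0]
    simp only [Matrix.cons_val_zero, Matrix.cons_val_one, Matrix.cons_val_two, Matrix.head_cons, Matrix.tail_cons,
      sub_zero] at hrev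
    rw [show c 0 ^ 2 + c 1 ^ 2 + (0 : ℝ) ^ 2 = c 0 ^ 2 + c 1 ^ 2 by ring] at hrev
    have hpos : 0 < 1 / ρ - Real.sqrt (c 0 ^ 2 + c 1 ^ 2) := by linarith
    have h1 : 1 / ρ - Real.sqrt (c 0 ^ 2 + c 1 ^ 2) < Real.sqrt ((q 0 - c 0) ^ 2 + (q 1 - c 1) ^ 2 + q 2 ^ 2) := by
      linarith
    have h2 := Real.lt_sqrt hpos.le |>.mp h1
    exact h2.le
  · -- (ii) `|c| ≥ 1/ρ`: `c` comes from the non-candidate `ψ(c)`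
    push Not at hs
    have hs0 : 0 < c 0 ^ 2 + c 1 ^ 2 := lt_of_lt_of_le (by positivity) hs
    set c₀ : Fin 2 → ℝ := ![n 0 + c 0 / (c 0 ^ 2 + c 1 ^ 2), n 1 + c 1 / (c 0 ^ 2 + c 1 ^ 2)] with hc₀
    have hdist : (c₀ 0 - n 0) ^ 2 + (c₀ 1 - n 1) ^ 2 = 1 / (c 0 ^ 2 + c 1 ^ 2) := by
      simp only [hc₀, Matrix.cons_val_zero, Matrix.cons_val_one]
      exact polyEnv_psi_dist n c hs0.ne'
    have hle : 1 / (c 0 ^ 2 + c 1 ^ 2) ≤ ρ ^ 2 := by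
      rw [div_le_iff₀ hs0]
      have := (div_le_iff₀ (by positivity : (0 : ℝ) < ρ ^ 2)).mp hs
      linarith
    have hc₀n : c₀ ≠ n := by
      intro h
      have : (c₀ 0 - n 0) ^ 2 + (c₀ 1 - n 1) ^ 2 = 0 := by rw [h]; ring
      rw [hdist] at this
      exact absurd this (by positivity)
    have hnotC : c₀ ∉ C := by
      intro hC
      have := hsep c₀ hC hc₀n
      rw [hdist] at this
      nlinarith
    obtain ⟨ε₀, hε₀, hfree₀⟩ := hfree c₀ hnotC
    -- continuity of the back map at `(c, 0)`
    have hc3 : (![c 0, c 1, 0] : Fin 3 → ℝ) 0 ^ 2 + (![c 0, c 1, 0] : Fin 3 → ℝ) 1 ^ 2 +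
        (![c 0, c 1, 0] : Fin 3 → ℝ) 2 ^ 2 ≠ 0 := by
      simp only [Matrix.cons_val_zero, Matrix.cons_val_one, Matrix.cons_val_two, Matrix.head_cons, Matrix.tail_cons]
      positivity
    obtain ⟨ε, hε, hcont⟩ := polyEnv_back_continuous n ![c 0, c 1, 0] hc3 ε₀ hε₀
    refine ⟨ε, hε, fun q hq => ?_⟩
    by_contra hlt
    push Not at hlt
    obtain ⟨-, hP, -⟩ := hmem q hq
    have hnear := hcont q (by simpa using hlt)
    simp only [Matrix.cons_val_zero, Matrix.cons_val_one, Matrix.cons_val_two, Matrix.head_cons, Matrix.tail_cons,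
      zero_div] at hnear
    rw [show (c 0 ^ 2 + c 1 ^ 2 + (0 : ℝ) ^ 2) = c 0 ^ 2 + c 1 ^ 2 by ring] at hnear
    have hfar := hfree₀ _ hP
    simp only [Matrix.cons_val_zero, Matrix.cons_val_one, Matrix.cons_val_two, Matrix.head_cons, Matrix.tail_cons,
      hc₀] at hfar
    -- `hnear` says the back image is within `ε₀` of `(c₀, 0)`; `hfar` says it is not
    have e1 : q 0 / (q 0 ^ 2 + q 1 ^ 2 + q 2 ^ 2) + n 0 - (c 0 / (c 0 ^ 2 + c 1 ^ 2) + n 0) =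
        q 0 / (q 0 ^ 2 + q 1 ^ 2 + q 2 ^ 2) + n 0 - (n 0 + c 0 / (c 0 ^ 2 + c 1 ^ 2)) := by ring
    have e2 : q 1 / (q 0 ^ 2 + q 1 ^ 2 + q 2 ^ 2) + n 1 - (c 1 / (c 0 ^ 2 + c 1 ^ 2) + n 1) =
        q 1 / (q 0 ^ 2 + q 1 ^ 2 + q 2 ^ 2) + n 1 - (n 1 + c 1 / (c 0 ^ 2 + c 1 ^ 2)) := by ring
    rw [e1, e2, sub_zero] at hnear
    linarith

end Summit.KontsevichZagierPeriods.HyperbolicBloch.OffTetraSectorKernel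

end
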